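import Mathlib
import Summits.ResolutionOfSingularities.ResolutionOfSingularities.Theorems.FrobeniusClosingSteerRankFourExitSpan
import Summits.ResolutionOfSingularities.ResolutionOfSingularities.Theorems.FrobeniusClosingSteerCotangentDerivationTwo

/-!
# B7 `rankFour_exit_two`, point-step case II: the polar rank drops across a quadratic transform
# (chain W4.1, crux `Steer`, σ-residual LOW half)

OURS (campaign res-hironaka, rung L, slot W4.1; helper for crux `Steer` stmt-ResolutionOfSingularities-16345;
res-L0-w41-strat-2's one-step lemma B7, STRAT2-MEMO-1 §4b). NOT a statement of any manuscript; nothing here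
is attributed to [claim: Hironaka2017, status: under-review]. AI-written; weaker than expert review.

`polarRank_of_pointStep`: along a quadratic transform `R ⊂ R₁` (along `O`, `R` dominated, both regular of
embedding dimension `4`, characteristic `2`, residues squares), a strict step `s = x·s₁ + g₀` of radicands
(`x ∈ 𝔪_R` of positive value) whose successor admits a cleaning `s₁² − g₁² ∈ 𝔪₁²` has
`s² ≡ g² + z·w (mod 𝔪_R³)` with `z, w ∈ 𝔪_R` — the cleaned quadratic part of `s²` has polar rank `≤ 2`.

Proof. `δ : R₁ → 𝔪₁/𝔪₁²` the cotangent derivation; `δ(s₁²) = 0`. With `φ = s² − g₀² ≡ Σ a_{jk} u_j u_k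
(mod 𝔪_R³)`, `x₀` the chart generator, `v_j = u_j/x₀`: `φ/x₀² = s₁² · (x/x₀)²` has `δ = 0`, and
`δ(φ/x₀²) = Σ_k (Σ_j (ā_{jk}+ā_{kj}) v̄_j) δv_k + Λ δx₀` (`delta_quadratic`, `delta_inclusion_mem_span`). The five
classes `δx₀, δv_j` span the `4`-space `𝔪₁/𝔪₁²` (`span_delta_eq_top`) with the relation from
`1 = Σ c_j v_j + x₀·r` (`x₀ = Σ c_j u_j + m₂`); so the displayed relation is a multiple `t` of that one
(`CotangentDerivation.exists_smul_of_two_relations`), and pairing with `v̄` (alternation,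
`CotangentDerivation.sum_polar_self_eq_zero`) gives `t = 0`: `v̄ ≠ 0` is a kernel vector of the polar matrix over
the residue field of `R₁`, and `CotangentQuadratic.polarRank_of_kernel` concludes. [folklore]
-/

noncomputable section

-- `Summit.<S>.<S>.…` duplicates the summit name by design (single-problem summit).
set_option linter.dupNamespace false

namespace Summit.ResolutionOfSingularities.ResolutionOfSingularities.Theorems.SwitchingDichotomy.RankFourExit

open IsLocalRing Module Literature.AlgebraicGeometry.Resolution
open Summit.ResolutionOfSingularities.ResolutionOfSingularities.Theorems.SwitchingDichotomy

-- `K : Type` (universe `0`) as in the skeleton of record and the quadratic-step lemmas it consumes.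
variable {K : Type} [Field K]

/-! ## The point-step case of B7 -/

/-- `δ` of a double sum of products `a_{jk} v_j v_k`: the «polar» part `Σ_k (Σ_j (ā_{jk} + ā_{kj}) v̄_j) • δ v_k`
plus the coefficient part `Σ_{j,k} (v̄_k v̄_j) • δ a_{jk}` (Leibniz, bookkeeping). [folklore] -/
theorem delta_quadratic {S : Type} [CommRing S] [IsLocalRing S] (δ : S → CotangentSpace S)
    (hδadd : ∀ a b : S, δ (a + b) = δ a + δ b)
    (hδmul : ∀ a b : S, δ (a * b) = residue S a • δ b + residue S b • δ a)
    {n : ℕ} (a : Fin n → Fin n → S) (v : Fin n → S) :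
    δ (∑ j, ∑ k, a j k * v j * v k) =
      ∑ k, (∑ j, (residue S (a j k) + residue S (a k j)) * residue S (v j)) • δ (v k) +
        ∑ j, ∑ k, (residue S (v k) * residue S (v j)) • δ (a j k) := by
  have hsum : ∀ (t : Finset (Fin n)) (g : Fin n → S), δ (∑ i ∈ t, g i) = ∑ i ∈ t, δ (g i) :=
    fun t g => map_sum (AddMonoidHom.mk' δ hδadd) g t
  have hterm : ∀ j k, δ (a j k * v j * v k) =
      (residue S (a j k) * residue S (v j)) • δ (v k) +
        (residue S (v k) * residue S (a j k)) • δ (v j) +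
        (residue S (v k) * residue S (v j)) • δ (a j k) := by
    intro j k
    rw [hδmul, hδmul, map_mul, smul_add, smul_smul, smul_smul, add_assoc]
  rw [hsum]
  simp_rw [hsum, hterm, Finset.sum_add_distrib]
  congr 1
  -- the two polar halves
  have h1 : ∑ j, ∑ k, (residue S (a j k) * residue S (v j)) • δ (v k) =
      ∑ k, (∑ j, residue S (a j k) * residue S (v j)) • δ (v k) := by
    rw [Finset.sum_comm]
    exact Finset.sum_congr rfl fun k _ => (Finset.sum_smul).symm
  have h2 : ∑ j, ∑ k, (residue S (v k) * residue S (a j k)) • δ (v j) =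
      ∑ k, (∑ j, residue S (a k j) * residue S (v j)) • δ (v k) := by
    refine Finset.sum_congr rfl fun j _ => ?_
    rw [Finset.sum_smul]
    exact Finset.sum_congr rfl fun k _ => by rw [mul_comm]
  rw [h1, h2, ← Finset.sum_add_distrib]
  refine Finset.sum_congr rfl fun k _ => ?_
  rw [← add_smul, ← Finset.sum_add_distrib]
  congr 1
  exact Finset.sum_congr rfl fun j _ => by ring

/-- **B7, point-step case.** Along a quadratic transform `R ⊂ R₁` (along `O`, `R` dominated, both regular of
embedding dimension `4`, characteristic `2`, residues squares), a strict step `s = x·s₁ + g₀` of radicands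
(`x ∈ 𝔪_R` of least value) whose successor admits a cleaning `s₁² − g₁² ∈ 𝔪₁²` has a predecessor whose cleaned
quadratic part has polar rank `≤ 2`: `s² ≡ g² + z·w (mod 𝔪_R³)`, `z, w ∈ 𝔪_R`. [folklore] -/
theorem polarRank_of_pointStep [CharP K 2] {O : ValuationSubring K} {R R₁ : Subring K}
    [IsRegularLocalRing R] [IsRegularLocalRing R₁] (hQT : IsQuadraticTransformAlong O R R₁)
    (hdom : SubringDominates R O.toSubring)
    (h4 : finrank (ResidueField R) (CotangentSpace R) = 4)
    (h4' : finrank (ResidueField R₁) (CotangentSpace R₁) = 4)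
    (hperf : ∀ a : R, ∃ b : R, a - b ^ 2 ∈ maximalIdeal R)
    (hperf' : ∀ a : R₁, ∃ b : R₁, a - b ^ 2 ∈ maximalIdeal R₁)
    {s s₁ x g₀ : K} (hs : s ^ 2 ∈ R) (hs₁ : s₁ ^ 2 ∈ R₁) (hxR : x ∈ R)
    (hvx : O.valuation x < 1) (hg₀ : g₀ ∈ R) (hstep : s = x * s₁ + g₀)
    (hnext : ∃ g₁ : R₁, (⟨s₁ ^ 2, hs₁⟩ : R₁) - g₁ ^ 2 ∈ maximalIdeal R₁ ^ 2) :
    ∃ g z w : R, z ∈ maximalIdeal R ∧ w ∈ maximalIdeal R ∧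
      (⟨s ^ 2, hs⟩ : R) - g ^ 2 - z * w ∈ maximalIdeal R ^ 3 := by
  classical
  -- setup
  have hRO : R ≤ O.toSubring := hQT.source_le
  have hR₁O : R₁ ≤ O.toSubring := hQT.target_le
  have hRR₁ : R ≤ R₁ := hQT.le
  have hdom₁ : SubringDominates R₁ O.toSubring := hQT.dominated
  have hval : ∀ a : R, a ∈ maximalIdeal R ↔ O.valuation (a : K) < 1 :=
    (subringDominates_valuationSubring_iff hRO).mp hdom
  have hval₁ : ∀ a : R₁, a ∈ maximalIdeal R₁ ↔ O.valuation (a : K) < 1 :=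
    (subringDominates_valuationSubring_iff hR₁O).mp hdom₁
  obtain ⟨_, x₀, hx₀m, hx₀0, hx₀max, hR₁⟩ := hQT.exists_eq_locAtCentre
  have hvx₀ : O.valuation (x₀ : K) < 1 := (hval x₀).mp hx₀m
  have hx₀K : (x₀ : K) ≠ 0 := fun h => hx₀0 (Subtype.ext h)
  have hmax' : ∀ y ∈ R, O.valuation y < 1 → O.valuation y ≤ O.valuation (x₀ : K) :=
    fun y hy hvy => hx₀max ⟨y, hy⟩ ((hval ⟨y, hy⟩).mpr hvy)
  haveI : CharP (ResidueField R₁) 2 := charP_residueField_two R₁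
  have h2R : (2 : R) = 0 := by
    have := CharP.cast_eq_zero R 2
    simpa using this
  have hB : blowupRing R (x₀ : K) ≤ R₁ := by rw [hR₁]; exact le_locAtCentre _ O
  -- `ψ : R → κ₁` and its kernel
  let ψ : R →+* ResidueField R₁ := (residue R₁).comp (Subring.inclusion hRR₁)
  have hψ : ∀ r : R, ψ r = 0 → r ∈ maximalIdeal R := by
    intro r hr
    have h1 : Subring.inclusion hRR₁ r ∈ maximalIdeal R₁ := (residue_eq_zero_iff _).mp hr
    exact (hval r).mpr ((hval₁ _).mp h1)
  -- lifted cotangent basis of `R`, and the quadratic expression of `φ = s² − g₀²`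
  obtain ⟨u, -, hu⟩ := CotangentQuadratic.exists_cotangentBasis (R := R) h4
  have hφ : (⟨s ^ 2 - g₀ ^ 2, sub_mem hs (pow_mem hg₀ 2)⟩ : R) ∈ maximalIdeal R ^ 2 :=
    QuadraticStep.sub_pow_mem_maximalIdeal_pow_of_step hQT hdom 2 hs hs₁ hxR hvx hg₀ hstep
  set φ : R := ⟨s ^ 2 - g₀ ^ 2, sub_mem hs (pow_mem hg₀ 2)⟩ with hφdef
  obtain ⟨a, -, ha⟩ := CotangentQuadratic.exists_matrix_of_mem_mul u hu (fun _ => True)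
    (fun _ _ _ _ => trivial) (maximalIdeal R) (maximalIdeal R) le_rfl le_rfl
    (fun _ _ _ _ _ _ _ _ => trivial) (show φ ∈ maximalIdeal R * maximalIdeal R by rwa [← pow_two])
  set m₃ : R := φ - ∑ j, ∑ k, a j k * (u j : R) * (u k : R) with hm₃
  -- the players in `R₁`
  have hvmem : ∀ j, ((u j : R) : K) / x₀ ∈ R₁ := fun j =>
    QuadraticStep.div_mem_of_isQuadraticTransformAlong hQT hdom x₀.2 hx₀K hvx₀ hmax' (u j : R).2
      ((hval _).mp (u j).2)
  let v : Fin 4 → R₁ := fun j => ⟨((u j : R) : K) / x₀, hvmem j⟩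
  have hv : ∀ j, (v j : K) = (u j : R) / x₀ := fun j => rfl
  let x₀' : R₁ := ⟨x₀, hRR₁ x₀.2⟩
  have hx₀' : (x₀' : K) = x₀ := rfl
  have hres0 : residue R₁ x₀' = 0 := by
    rw [residue_eq_zero_iff]
    exact QuadraticStep.mem_maximalIdeal_of_valuation_lt_one hR₁O x₀' hvx₀
  have hex : x / x₀ ∈ R₁ :=
    QuadraticStep.div_mem_of_isQuadraticTransformAlong hQT hdom x₀.2 hx₀K hvx₀ hmax' hxR hvx
  let ex : R₁ := ⟨x / x₀, hex⟩
  have hr₃ : (m₃ : K) / (x₀ : K) ^ 3 ∈ R₁ := hB (QuadraticStep.div_pow_mem_blowupRing x₀ ha)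
  let r₃ : R₁ := ⟨(m₃ : K) / (x₀ : K) ^ 3, hr₃⟩
  let f₁ : R₁ := ⟨s₁ ^ 2, hs₁⟩
  let a' : Fin 4 → Fin 4 → R₁ := fun j k => ⟨(a j k : K), hRR₁ (a j k).2⟩
  -- the key identity in `R₁`: `f₁ · (x/x₀)² = Σ a_{jk} v_j v_k + x₀ · (m₃ / x₀³)`
  have hident : f₁ * ex ^ 2 = ∑ j, ∑ k, a' j k * v j * v k + x₀' * r₃ := by
    apply Subtype.ext
    show s₁ ^ 2 * (x / x₀) ^ 2 = ((∑ j, ∑ k, a' j k * v j * v k + x₀' * r₃ : R₁) : K)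
    push_cast
    simp only [hv, hx₀']
    have hm₃K : (m₃ : K) = (s ^ 2 - g₀ ^ 2) - ∑ j, ∑ k, (a j k : K) * (u j : R) * (u k : R) := by
      rw [hm₃]; push_cast; rw [hφdef]
    have hsq : s ^ 2 - g₀ ^ 2 = x ^ 2 * s₁ ^ 2 := by
      have h2K : (2 : K) = 0 := by
        have := CharP.cast_eq_zero K 2
        simpa using this
      rw [hstep]; linear_combination (x * s₁ * g₀) * h2K
    rw [show ((r₃ : R₁) : K) = (m₃ : K) / (x₀ : K) ^ 3 from rfl, hm₃K, hsq]
    show s₁ ^ 2 * (x / x₀) ^ 2 = ∑ j, ∑ k, (a j k : K) * ((u j : R) / (x₀ : K)) * ((u k : R) / (x₀ : K)) +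
      (x₀ : K) * ((x ^ 2 * s₁ ^ 2 - ∑ j, ∑ k, (a j k : K) * (u j : R) * (u k : R)) / (x₀ : K) ^ 3)
    have e1 : ∀ j k, (a j k : K) * ((u j : R) / (x₀ : K)) * ((u k : R) / (x₀ : K)) =
        (a j k : K) * (u j : R) * (u k : R) / (x₀ : K) ^ 2 := fun j k => by
      field_simp
    simp only [e1, ← Finset.sum_div]
    field_simp
    ring
  -- the cotangent derivation of `R₁`
  obtain ⟨δ, hδwd, hδadd, hδmul, hδmem, hδsq⟩ :=
    CotangentDerivation.exists_cotangentDerivation (R := R₁) hperf'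
  have hδsum : ∀ (g : Fin 4 → R₁), δ (∑ i, g i) = ∑ i, δ (g i) :=
    fun g => map_sum (AddMonoidHom.mk' δ hδadd) g _
  -- `δ f₁ = 0`, hence `δ` of the right-hand side vanishes
  obtain ⟨g₁, hg₁⟩ := hnext
  have hδf₁ : δ f₁ = 0 := by
    have h1 : f₁ - g₁ ^ 2 ∈ maximalIdeal R₁ := Ideal.pow_le_self two_ne_zero hg₁
    rw [hδwd f₁ g₁ h1, Ideal.toCotangent_eq_zero]
    exact hg₁
  have hδrhs : δ (∑ j, ∑ k, a' j k * v j * v k + x₀' * r₃) = 0 := by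
    rw [← hident, hδmul, hδsq, hδf₁, smul_zero, smul_zero, add_zero]
  -- the line `L₀ = κ₁ · δ x₀'` contains `δ` of every old element
  set L₀ : Submodule (ResidueField R₁) (CotangentSpace R₁) :=
    Submodule.span (ResidueField R₁) {δ x₀'} with hL₀
  have hold : ∀ r : R, δ (Subring.inclusion hRR₁ r) ∈ L₀ := fun r =>
    delta_inclusion_mem_span hQT hdom hperf x₀ hx₀m hx₀0 hx₀max x₀' hx₀' δ hδadd hδmul hδsq r
  -- relation (R1): the polar vector `E`
  let vbar : Fin 4 → ResidueField R₁ := fun j => residue R₁ (v j)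
  let E : Fin 4 → ResidueField R₁ := fun k => ∑ j, ψ (a j k + a k j) * vbar j
  have hE : ∀ k, E k = ∑ j, (residue R₁ (a' j k) + residue R₁ (a' k j)) * residue R₁ (v j) :=
    fun k => Finset.sum_congr rfl fun j _ => by simp only [ψ, RingHom.comp_apply, map_add]; rfl
  have hR1mem : ∑ k, E k • δ (v k) ∈ L₀ := by
    have hq := delta_quadratic δ hδadd hδmul a' v
    have hx : δ (x₀' * r₃) = residue R₁ r₃ • δ x₀' := by
      rw [hδmul, hres0, zero_smul, zero_add]
    have hsum : ∑ k, E k • δ (v k) =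
        -(∑ j, ∑ k, (residue R₁ (v k) * residue R₁ (v j)) • δ (a' j k) + residue R₁ r₃ • δ x₀') := by
      rw [eq_neg_iff_add_eq_zero, ← add_assoc]
      have : ∑ k, E k • δ (v k) =
          ∑ k, (∑ j, (residue R₁ (a' j k) + residue R₁ (a' k j)) * residue R₁ (v j)) • δ (v k) :=
        Finset.sum_congr rfl fun k _ => by rw [hE]
      rw [this, ← hq, ← hx, ← hδadd]
      exact hδrhs
    rw [hsum]
    refine L₀.neg_mem (add_mem (Submodule.sum_mem _ fun j _ => Submodule.sum_mem _ fun k _ =>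
      Submodule.smul_mem _ _ (hold (a j k))) (Submodule.smul_mem _ _ (Submodule.mem_span_singleton_self _)))
  obtain ⟨t₁, ht₁⟩ := Submodule.mem_span_singleton.mp hR1mem
  -- relation (R0): from `x₀ = Σ c_j u_j + m₂`
  obtain ⟨c, hc, -⟩ := CotangentQuadratic.exists_coords u hu x₀ hx₀m
  set m₂ : R := x₀ - ∑ j, c j * (u j : R) with hm₂
  have hr₂ : (m₂ : K) / (x₀ : K) ^ 2 ∈ R₁ := hB (QuadraticStep.div_pow_mem_blowupRing x₀ hc)
  let r₂ : R₁ := ⟨(m₂ : K) / (x₀ : K) ^ 2, hr₂⟩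
  have hone : (1 : R₁) = ∑ j, Subring.inclusion hRR₁ (c j) * v j + x₀' * r₂ := by
    apply Subtype.ext
    show (1 : K) = ((∑ j, Subring.inclusion hRR₁ (c j) * v j + x₀' * r₂ : R₁) : K)
    push_cast
    simp only [hv, hx₀']
    show (1 : K) = ∑ j, ((c j : R) : K) * ((u j : R) / (x₀ : K)) + (x₀ : K) * ((m₂ : K) / (x₀ : K) ^ 2)
    rw [hm₂]
    push_cast
    have e1 : ∀ j, ((c j : R) : K) * ((u j : R) / (x₀ : K)) = ((c j : R) : K) * (u j : R) / (x₀ : K) :=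
      fun j => by field_simp
    simp only [e1, ← Finset.sum_div]
    field_simp
    ring
  have hcbar1 : ∑ j, ψ (c j) * vbar j = 1 := by
    have := congrArg (residue R₁) hone
    rw [map_one, map_add, map_sum, map_mul, hres0, zero_mul, add_zero] at this
    rw [this]
    exact Finset.sum_congr rfl fun j _ => by simp only [ψ, vbar, map_mul, RingHom.comp_apply]
  have hvbar : vbar ≠ 0 := by
    intro h0
    have : ∑ j, ψ (c j) * vbar j = 0 := Finset.sum_eq_zero fun j _ => by
      rw [show vbar j = 0 from congr_fun h0 j, mul_zero]
    rw [hcbar1] at this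
    exact one_ne_zero this
  have hcbar : (fun j => ψ (c j)) ≠ 0 := by
    intro h0
    apply QuadraticStep.not_mem_sq_of_forall_valuation_le hdom hx₀K hx₀max
    have hcm : ∀ j, c j ∈ maximalIdeal R := fun j => hψ _ (congr_fun h0 j)
    have : x₀ = m₂ + ∑ j, c j * (u j : R) := by rw [hm₂]; ring
    rw [this, pow_two]
    refine add_mem (by rw [← pow_two]; exact hc) (Ideal.sum_mem _ fun j _ => ?_)
    exact Ideal.mul_mem_mul (hcm j) (u j).2
  have hR0mem : ∑ j, ψ (c j) • δ (v j) ∈ L₀ := by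
    have h0 : δ (∑ j, Subring.inclusion hRR₁ (c j) * v j + x₀' * r₂) = 0 := by
      rw [← hone]; simpa using hδsq 1
    rw [hδadd, hδsum, hδmul x₀' r₂, hres0, zero_smul, zero_add] at h0
    simp_rw [hδmul] at h0
    rw [Finset.sum_add_distrib] at h0
    have hsum : ∑ j, ψ (c j) • δ (v j) =
        -(∑ j, residue R₁ (v j) • δ (Subring.inclusion hRR₁ (c j)) + residue R₁ r₂ • δ x₀') := by
      rw [eq_neg_iff_add_eq_zero, ← add_assoc]
      exact h0
    rw [hsum]
    exact L₀.neg_mem (add_mem (Submodule.sum_mem _ fun j _ => Submodule.smul_mem _ _ (hold (c j)))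
      (Submodule.smul_mem _ _ (Submodule.mem_span_singleton_self _)))
  obtain ⟨t₀, ht₀⟩ := Submodule.mem_span_singleton.mp hR0mem
  -- the span, and the relation count
  have hspan := span_delta_eq_top hQT hdom hperf x₀ hx₀m hx₀0 hx₀max hR₁ x₀' hx₀' u hu v hv δ hδadd
    hδmul hδmem hδsq
  obtain ⟨t, ht⟩ := CotangentDerivation.exists_smul_of_two_relations (V := CotangentSpace R₁) h4'
    (δ x₀') (fun j => δ (v j)) hspan (fun j => ψ (c j)) (-t₀) hcbar
    (by rw [neg_smul, ht₀, add_neg_cancel]) E (-t₁) (by rw [neg_smul, ht₁, add_neg_cancel])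
  -- alternation kills `t`
  have ht0 : t = 0 := by
    have hself : ∑ k, E k * vbar k = 0 := by
      have := CotangentDerivation.sum_polar_self_eq_zero (fun j k => ψ (a j k)) vbar
      refine (Finset.sum_congr rfl fun k _ => ?_).trans this
      simp only [E, map_add]
    have : ∑ k, E k * vbar k = t := by
      calc ∑ k, E k * vbar k = t * ∑ k, ψ (c k) * vbar k := by
            rw [Finset.mul_sum]
            exact Finset.sum_congr rfl fun k _ => by rw [ht k]; ring
        _ = t := by rw [hcbar1, mul_one]
    rw [← this, hself]
  have hker : ∀ k, ∑ j, ψ (a j k + a k j) * vbar j = 0 := fun k => by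
    have := ht k
    rw [ht0, zero_mul] at this
    exact this
  -- the endgame in `R`
  obtain ⟨ℓ, z, w, hz, hw, hfin⟩ := CotangentQuadratic.polarRank_of_kernel hperf a
    (fun j => (u j : R)) (fun j => (u j).2) ψ hψ vbar hvbar hker
  refine ⟨⟨g₀, hg₀⟩ + ℓ, z, w, hz, hw, ?_⟩
  have e : (⟨s ^ 2, hs⟩ : R) - (⟨g₀, hg₀⟩ + ℓ) ^ 2 - z * w =
      m₃ + ((∑ j, ∑ k, a j k * (u j : R) * (u k : R)) - ℓ ^ 2 - z * w) - (⟨g₀, hg₀⟩ * ℓ) * 2 := by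
    rw [hm₃, hφdef]
    have : (⟨s ^ 2, hs⟩ : R) = ⟨s ^ 2 - g₀ ^ 2, sub_mem hs (pow_mem hg₀ 2)⟩ + ⟨g₀, hg₀⟩ ^ 2 := by
      apply Subtype.ext; push_cast; ring
    rw [this]; ring
  rw [e, h2R, mul_zero, sub_zero]
  exact add_mem ha hfin

end Summit.ResolutionOfSingularities.ResolutionOfSingularities.Theorems.SwitchingDichotomy.RankFourExit

end
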